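import Summits.BirchSwinnertonDyer.BirchSwinnertonDyer.Theorems.GenusKolyvaginAtTwoPowDvdShaCardAtTwoRTNonPhantomPowAtMultiplicative
import Summits.BirchSwinnertonDyer.BirchSwinnertonDyer.Theorems.GenusKolyvaginAtTwoPowDvdShaCardAtTwoRTNonPhantomHabitat
import Summits.BirchSwinnertonDyer.BirchSwinnertonDyer.Theorems.GenusKolyvaginAtTwoGenusPrimitiveSupplyAtTwoTwoAdicImageOverKH1
import Literature.NumberTheory.EllipticCurves.AnticyclotomicHeegnerPlacesDecompositionProofs
import HarnessLib

/-!
# Route `GenusKolyvaginAtTwo`, crux L_T `PowDvdShaCardAtTwoRT` (stmt-BirchSwinnertonDyer-23242), LINE 18 stub L, bottom rung: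
# the NON-PHANTOM lemma at every level `2^L` — (F) HABITAT FORM and the LEAD's displayed hypothesis `(NPh_M)` of
# `hres_of_nonPhantom_pow` / `false_of_bottomRung_engine_deep`, DISCHARGED AT EVERY LEVEL `M ≥ 1` on the sub-habitat
# «some odd prime of multiplicative reduction»

Seat `bsd-line-gk2-p3` g22 (PROVER 3/3, cell `bsd-f1-sign2`), `--supports stmt-BirchSwinnertonDyer-23242` (helper).
THEOREMS ONLY (no definition, no named fact, no `sorry`). BSD is not proved by any of this; neither is the crux.

WHAT.  LEAD gk2-p1 g17 (`…RTNonPhantomHres.lean`, `…RTBottomRungEngineDeep.lean`, memo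
`Cruxes/PowDvdShaCardAtTwoRT/Lines/plus-descent-lead-g17.md` §6) reduced every separation hypothesis `hres` of LINE 18's bottom
rung (pair Čebotarev at level `2^L`, deep swap) to ONE displayed hypothesis per level `M`,
  `(NPh_M)  ∀ z : H¹(K, E_K[2^M]), (∀ ρ ∈ Γ_{K(E[2^M])}, [z, ρ] = 0) → (∀ w, z ∈ selmerLocalKer E_K K_w (2^M)) → z = 0`.
Files (VI)/(VII) discharged `M = 2`.  THIS FILE discharges `(NPh_M)` for EVERY `M ≥ 1` on the habitat of `PowDvdShaCardAtTwoRT`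
(`Odd (∏ c_p)`, `ρ_{E,2^∞}` onto, `K` imaginary quadratic with `d_K` odd, `d_K·(−|Δ|)`, `d_K·(−2|Δ|)` non-squares) as soon as `E/ℚ`
has ONE odd prime `p` of multiplicative reduction and `w ∣ p` is unramified (automatic under the Heegner hypothesis for `p ∣ N`):
* `hres_baseChange_of_hasMultiplicativeReductionAt_pow`, `eq_zero_baseChange_of_phantom_of_mem_selmerLocalKer_pow` — level `2^L`,
  Kummer at the single place `w`;
* `nonPhantom_baseChange_of_hasMultiplicativeReductionAt_pow` — `(NPh_M)` verbatim, every `M ≥ 1`;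
* `nonPhantom_baseChange_of_heegner_pow` — the same in the route's Heegner frame (`N ≠ 0`, Heegner hypothesis, `N ∈ w`, `2 ∉ w`,
  `E` multiplicative at `w ∩ ℤ`); `nonPhantom_baseChange_of_heegner_of_hasMultiplicativeReductionAt_pow` — the same from a place
  `v ∤ 2` of ℚ with `N ∈ v` and `E` multiplicative at `v` (the prime `w ∣ v` of `K` is produced inside).
Ingredients: file (E) at `w` (the inertial Tate transvection, principality of Kummer classes on it, and the injectivity
`H¹(GL₂(ℤ/2^L), (ℤ/2^L)²) → H¹(⟨u⟩, ·)` of files (A)–(D)); file (VI)'s `odd_ordMinimalDiscriminant_of_odd_tamagawaProduct`;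
Silverman VII.5.4 (b) (multiplicative reduction and `ord Δ_min` ascend along `e(w|v) = 1`); gk2-p5's
`hasSurjectiveModNGaloisRep_baseChange_two_pow_natCast` (`Gal(K(E[2^M])/K) = GL₂(ℤ/2^M)` on the habitat).
RESIDUAL (unchanged, honest): curves with NO odd multiplicative prime (`N = 2^a ·` additive part) are not covered — there the
Selmer membership of a phantom is decided at the places over `2` only (gk2-p5 g20 `…RTNonPhantomAdditive.lean`).

References: [LawsonWuthrich2016] §7.1, §8; [GrossLMS1991] §1, Prop. 9.1; [SilvermanAEC2009] VII.5.4 (b); [McCallumLMS1991] §3.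
-/

-- `Summit.<P>.<Sub>` repeats `BirchSwinnertonDyer` by the tree's layout convention (D-0017)
set_option linter.dupNamespace false
set_option autoImplicit false

noncomputable section

open scoped Classical
open NumberField IsDedekindDomain Field

namespace Summit.BirchSwinnertonDyer.BirchSwinnertonDyer.Theorems.GenusExact.NonPhantomPow

open WeierstrassCurve Literature.NumberTheory.EllipticCurves Literature.NumberTheory.GaloisRepresentations
  Summit.BirchSwinnertonDyer.BirchSwinnertonDyer.Theorems.GenusKolyTwoAdicK
open Summit.BirchSwinnertonDyer.BirchSwinnertonDyer.Theorems.GenusExact.NonPhantom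
  (odd_ordMinimalDiscriminant_of_odd_tamagawaProduct)

variable (W : WeierstrassCurve ℚ) [W.IsElliptic] {K : Type} [Field K] [NumberField K]

/-- **HABITAT FORM of the non-phantom lemma, every level `2^L` (`L ≥ 1`).**  `E/ℚ` with `Odd (∏ c_p)` and `ρ_{E,2^n}` onto for all
`n ≥ 1`; `K` imaginary quadratic, `d_K` odd, `d_K·(−|Δ|)`, `d_K·(−2|Δ|)` non-squares; `v ∤ 2` a place of ℚ of MULTIPLICATIVE
reduction, `w ∣ v` a place of `K` with `e(w|v) = 1`.  Then for `c, y ∈ H¹(K, E[2^L])` Kummer at `w`, no non-zero `a • c + b • y`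
dies on `Γ_{K(E[2^L])}` — the separation hypothesis `hres` of the pair Čebotarev at level `2^L`.
[cite: LawsonWuthrich2016, §7.1 and §8] [cite: SilvermanAEC2009, VII.5 Prop. 5.4 (b)] [cite: McCallumLMS1991, §3 Cor. 3.2] -/
theorem hres_baseChange_of_hasMultiplicativeReductionAt_pow
    (hT : Odd W.tamagawaProduct) (hρ : ∀ n : ℕ, 0 < n → W.HasSurjectiveModNGaloisRep ((2 : ℤ) ^ n))
    (hK : IsImaginaryQuadratic K) (hdK : Odd (NumberField.discr K))
    (hns₁ : ¬ IsSquare ((NumberField.discr K : ℚ) * -|W.Δ|))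
    (hns₂ : ¬ IsSquare ((NumberField.discr K : ℚ) * (-(2 * |W.Δ|))))
    {v : HeightOneSpectrum (𝓞 ℚ)} (h2v : ((2 : ℕ) : 𝓞 ℚ) ∉ v.asIdeal) (hmult : W.HasMultiplicativeReductionAt v)
    (w : HeightOneSpectrum (𝓞 K)) [w.asIdeal.LiesOver v.asIdeal] (he : w.asIdeal.ramificationIdx (𝓞 ℚ) = 1)
    {L : ℕ} (hL : 1 ≤ L) {n : ℤ} (hn : n = ((2 ^ L : ℕ) : ℤ)) {c y : galH1Torsion (W.baseChange K) n}
    (hc : c ∈ selmerLocalKer (W.baseChange K) (w.adicCompletion K) n)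
    (hy : y ∈ selmerLocalKer (W.baseChange K) (w.adicCompletion K) n) :
    ∀ a b : ℤ, (∀ ρ ∈ torsionFixing (W.baseChange K) n, h1Eval (W.baseChange K) n (a • c + b • y) ρ = 0) →
      a • c + b • y = 0 := by
  haveI : (W.baseChange K).IsElliptic := inferInstanceAs ((W.map (algebraMap ℚ K)).IsElliptic)
  -- multiplicative reduction and `ord Δ` ascend to `w` (Silverman VII.5.4 (b); `e(w|v) = 1`)
  have hmultK : (W.baseChange K).HasMultiplicativeReductionAt w :=
    hasMultiplicativeReductionAt_baseChange_of_liesOver (L := K) (v := v) (w := w) W hmult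
  have hordK : (W.baseChange K).ordMinimalDiscriminant w = W.ordMinimalDiscriminant v := by
    rw [ordMinimalDiscriminant_baseChange_of_isSemistableAt (L := K) (v := v) (w := w) W (Or.inr hmult),
      Ideal.ramificationIdx'_eq_ramificationIdx v.asIdeal w.asIdeal v.ne_bot, he, one_mul]
  have hodd : Odd ((W.baseChange K).ordMinimalDiscriminant w) := by
    rw [hordK]; exact odd_ordMinimalDiscriminant_of_odd_tamagawaProduct W hT hmult
  -- `w ∤ 2`
  have h2w : ((2 : ℕ) : 𝓞 K) ∉ w.asIdeal := by
    intro h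
    apply h2v
    rw [Ideal.LiesOver.over (P := w.asIdeal) (p := v.asIdeal), Ideal.under_def, Ideal.mem_comap, map_natCast]
    exact h
  -- `Gal(K(E[2^L])/K) = GL₂(ℤ/2^L)`
  have hρK : (W.baseChange K).HasSurjectiveModNGaloisRep n := by
    rw [hn]; exact hasSurjectiveModNGaloisRep_baseChange_two_pow_natCast W hK hdK hns₁ hns₂ hρ (by omega)
  exact hres_of_mem_selmerLocalKer_pow (W.baseChange K) hmultK h2w hodd hL hn hρK hc hy

/-- **A phantom class of `H¹(K, E[2^L])` that is Kummer at one odd multiplicative place is zero** (single-class form).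
[cite: LawsonWuthrich2016, §7.1 and §8] -/
theorem eq_zero_baseChange_of_phantom_of_mem_selmerLocalKer_pow
    (hT : Odd W.tamagawaProduct) (hρ : ∀ n : ℕ, 0 < n → W.HasSurjectiveModNGaloisRep ((2 : ℤ) ^ n))
    (hK : IsImaginaryQuadratic K) (hdK : Odd (NumberField.discr K))
    (hns₁ : ¬ IsSquare ((NumberField.discr K : ℚ) * -|W.Δ|))
    (hns₂ : ¬ IsSquare ((NumberField.discr K : ℚ) * (-(2 * |W.Δ|))))
    {v : HeightOneSpectrum (𝓞 ℚ)} (h2v : ((2 : ℕ) : 𝓞 ℚ) ∉ v.asIdeal) (hmult : W.HasMultiplicativeReductionAt v)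
    (w : HeightOneSpectrum (𝓞 K)) [w.asIdeal.LiesOver v.asIdeal] (he : w.asIdeal.ramificationIdx (𝓞 ℚ) = 1)
    {L : ℕ} (hL : 1 ≤ L) {n : ℤ} (hn : n = ((2 ^ L : ℕ) : ℤ)) {z : galH1Torsion (W.baseChange K) n}
    (hz : ∀ ρ ∈ torsionFixing (W.baseChange K) n, h1Eval (W.baseChange K) n z ρ = 0)
    (hzw : z ∈ selmerLocalKer (W.baseChange K) (w.adicCompletion K) n) : z = 0 := by
  have h := hres_baseChange_of_hasMultiplicativeReductionAt_pow W hT hρ hK hdK hns₁ hns₂ h2v hmult w he hL hn hzw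
    ((selmerLocalKer (W.baseChange K) (w.adicCompletion K) n).zero_mem) 1 0
    (by rw [one_smul, zero_smul, add_zero]; exact hz)
  rwa [one_smul, zero_smul, add_zero] at h

/-- **`(NPh_M)` at a given odd multiplicative place, every level `M ≥ 1`.**  The LEAD's displayed hypothesis of
`hres_of_nonPhantom_pow` / `false_of_bottomRung_engine_deep` VERBATIM at level `2^M`, for `E_K = W.baseChange K`, from a place
`v ∤ 2` of ℚ where `E` is multiplicative and a prime `w ∣ v` of `K` with `e(w|v) = 1` (the Kummer hypothesis of `(NPh_M)` at ALL
places is used at `w` only). [cite: LawsonWuthrich2016, §7.1 and §8] -/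
theorem nonPhantom_baseChange_of_hasMultiplicativeReductionAt_pow
    (hT : Odd W.tamagawaProduct) (hρ : ∀ n : ℕ, 0 < n → W.HasSurjectiveModNGaloisRep ((2 : ℤ) ^ n))
    (hK : IsImaginaryQuadratic K) (hdK : Odd (NumberField.discr K))
    (hns₁ : ¬ IsSquare ((NumberField.discr K : ℚ) * -|W.Δ|))
    (hns₂ : ¬ IsSquare ((NumberField.discr K : ℚ) * (-(2 * |W.Δ|))))
    {v : HeightOneSpectrum (𝓞 ℚ)} (h2v : ((2 : ℕ) : 𝓞 ℚ) ∉ v.asIdeal) (hmult : W.HasMultiplicativeReductionAt v)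
    (w : HeightOneSpectrum (𝓞 K)) [w.asIdeal.LiesOver v.asIdeal] (he : w.asIdeal.ramificationIdx (𝓞 ℚ) = 1)
    {M : ℕ} (hM : 1 ≤ M) :
    ∀ z : galH1Torsion (W.baseChange K) ((2 ^ M : ℕ) : ℤ),
      (∀ ρ ∈ torsionFixing (W.baseChange K) ((2 ^ M : ℕ) : ℤ), h1Eval (W.baseChange K) ((2 ^ M : ℕ) : ℤ) z ρ = 0) →
      (∀ w' : HeightOneSpectrum (𝓞 K), z ∈ selmerLocalKer (W.baseChange K) (w'.adicCompletion K) ((2 ^ M : ℕ) : ℤ)) →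
      z = 0 :=
  fun _ hz hzS ↦ eq_zero_baseChange_of_phantom_of_mem_selmerLocalKer_pow W hT hρ hK hdK hns₁ hns₂ h2v hmult w he hM rfl hz
    (hzS w)

/-- **`(NPh_M)` in the route's frame (Heegner form), every level `M ≥ 1`.**  `K` satisfies the Heegner hypothesis for `N ≠ 0`;
`w` is a prime of `K` containing `N` and not containing `2`; `E` has multiplicative reduction at the prime `w ∩ ℤ` below `w` (for
`N` the conductor: some odd `p ∥ N` and `w ∣ p`).  Then `(NPh_M)` holds for `E_K` at every level `2^M`, `M ≥ 1`.  The ramification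
index `e(w|p) = 1` comes from the Heegner hypothesis.
[cite: GrossLMS1991, §1 (the Heegner hypothesis)] [cite: LawsonWuthrich2016, §7.1 and §8] -/
theorem nonPhantom_baseChange_of_heegner_pow
    (hT : Odd W.tamagawaProduct) (hρ : ∀ n : ℕ, 0 < n → W.HasSurjectiveModNGaloisRep ((2 : ℤ) ^ n))
    (hK : IsImaginaryQuadratic K) (hdK : Odd (NumberField.discr K))
    (hns₁ : ¬ IsSquare ((NumberField.discr K : ℚ) * -|W.Δ|))
    (hns₂ : ¬ IsSquare ((NumberField.discr K : ℚ) * (-(2 * |W.Δ|))))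
    {N : ℕ} (hN : N ≠ 0) (hH : SatisfiesHeegnerHypothesis N K)
    (w : HeightOneSpectrum (𝓞 K)) (hNw : ((N : ℕ) : 𝓞 K) ∈ w.asIdeal) (h2w : ((2 : ℕ) : 𝓞 K) ∉ w.asIdeal)
    (hmult : W.HasMultiplicativeReductionAt (w.under (𝓞 ℚ))) {M : ℕ} (hM : 1 ≤ M) :
    ∀ z : galH1Torsion (W.baseChange K) ((2 ^ M : ℕ) : ℤ),
      (∀ ρ ∈ torsionFixing (W.baseChange K) ((2 ^ M : ℕ) : ℤ), h1Eval (W.baseChange K) ((2 ^ M : ℕ) : ℤ) z ρ = 0) →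
      (∀ w' : HeightOneSpectrum (𝓞 K), z ∈ selmerLocalKer (W.baseChange K) (w'.adicCompletion K) ((2 ^ M : ℕ) : ℤ)) →
      z = 0 := by
  haveI : w.asIdeal.LiesOver (w.under (𝓞 ℚ)).asIdeal := ⟨rfl⟩
  have he : w.asIdeal.ramificationIdx (𝓞 ℚ) = 1 :=
    (ramificationIdx_eq_one_and_inertiaDeg_eq_one_of_natCast_mem_of_satisfiesHeegnerHypothesis hK.1 hH hN w hNw).1
  have h2v : ((2 : ℕ) : 𝓞 ℚ) ∉ (w.under (𝓞 ℚ)).asIdeal := fun h ↦ h2w (by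
    rw [HeightOneSpectrum.under_asIdeal, Ideal.under_def, Ideal.mem_comap, map_natCast] at h
    exact h)
  exact nonPhantom_baseChange_of_hasMultiplicativeReductionAt_pow W hT hρ hK hdK hns₁ hns₂ h2v hmult w he hM

/-- **`(NPh_M)` from an odd multiplicative place of ℚ dividing the Heegner level, every `M ≥ 1`** — the consumer-ready form: `K`
satisfies the Heegner hypothesis for `N ≠ 0`, `v ∤ 2` is a place of ℚ with `N ∈ v` at which `E` is multiplicative (for `N` the
conductor: an odd `p ∥ N`); the prime `w ∣ v` of `K` is produced here (`e(w|v) = 1` by the Heegner hypothesis).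
[cite: GrossLMS1991, §1 (the Heegner hypothesis)] [cite: LawsonWuthrich2016, §7.1 and §8] -/
theorem nonPhantom_baseChange_of_heegner_of_hasMultiplicativeReductionAt_pow
    (hT : Odd W.tamagawaProduct) (hρ : ∀ n : ℕ, 0 < n → W.HasSurjectiveModNGaloisRep ((2 : ℤ) ^ n))
    (hK : IsImaginaryQuadratic K) (hdK : Odd (NumberField.discr K))
    (hns₁ : ¬ IsSquare ((NumberField.discr K : ℚ) * -|W.Δ|))
    (hns₂ : ¬ IsSquare ((NumberField.discr K : ℚ) * (-(2 * |W.Δ|))))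
    {N : ℕ} (hN : N ≠ 0) (hH : SatisfiesHeegnerHypothesis N K)
    {v : HeightOneSpectrum (𝓞 ℚ)} (h2v : ((2 : ℕ) : 𝓞 ℚ) ∉ v.asIdeal) (hNv : ((N : ℕ) : 𝓞 ℚ) ∈ v.asIdeal)
    (hmult : W.HasMultiplicativeReductionAt v) {M : ℕ} (hM : 1 ≤ M) :
    ∀ z : galH1Torsion (W.baseChange K) ((2 ^ M : ℕ) : ℤ),
      (∀ ρ ∈ torsionFixing (W.baseChange K) ((2 ^ M : ℕ) : ℤ), h1Eval (W.baseChange K) ((2 ^ M : ℕ) : ℤ) z ρ = 0) →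
      (∀ w' : HeightOneSpectrum (𝓞 K), z ∈ selmerLocalKer (W.baseChange K) (w'.adicCompletion K) ((2 ^ M : ℕ) : ℤ)) →
      z = 0 := by
  haveI : v.asIdeal.IsMaximal := Ideal.IsPrime.isMaximal v.isPrime v.ne_bot
  obtain ⟨Q, hQmax, hQover⟩ := Ideal.exists_maximal_ideal_liesOver_of_isIntegral (R := 𝓞 ℚ) (S := 𝓞 K) v.asIdeal
  have hNQ : ((N : ℕ) : 𝓞 K) ∈ Q := by
    rw [hQover.over, Ideal.under_def, Ideal.mem_comap, map_natCast] at hNv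
    exact hNv
  have hQ0 : Q ≠ ⊥ := by
    intro hQ
    rw [hQ, Ideal.mem_bot, Nat.cast_eq_zero] at hNQ
    exact hN hNQ
  -- the place `w = Q` of `K` over `v`
  obtain ⟨w, hw⟩ : ∃ w : HeightOneSpectrum (𝓞 K), w.asIdeal = Q := ⟨⟨Q, hQmax.isPrime, hQ0⟩, rfl⟩
  haveI : w.asIdeal.LiesOver v.asIdeal := by rw [hw]; exact hQover
  have hNw : ((N : ℕ) : 𝓞 K) ∈ w.asIdeal := by rw [hw]; exact hNQ
  have he : w.asIdeal.ramificationIdx (𝓞 ℚ) = 1 :=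
    (ramificationIdx_eq_one_and_inertiaDeg_eq_one_of_natCast_mem_of_satisfiesHeegnerHypothesis hK.1 hH hN w hNw).1
  exact nonPhantom_baseChange_of_hasMultiplicativeReductionAt_pow W hT hρ hK hdK hns₁ hns₂ h2v hmult w he hM

/-- A prime of `K` over a place `v` of ℚ containing the Heegner level `N ≠ 0`: it lies over `v`, is unramified (`e(w|v) = 1`, by
the Heegner hypothesis) and contains `N`. [cite: GrossLMS1991, §1 (the Heegner hypothesis)] -/
theorem exists_place_liesOver_of_satisfiesHeegnerHypothesis (hK : IsImaginaryQuadratic K) {N : ℕ} (hN : N ≠ 0)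
    (hH : SatisfiesHeegnerHypothesis N K) {v : HeightOneSpectrum (𝓞 ℚ)} (hNv : ((N : ℕ) : 𝓞 ℚ) ∈ v.asIdeal) :
    ∃ w : HeightOneSpectrum (𝓞 K), w.asIdeal.LiesOver v.asIdeal ∧ w.asIdeal.ramificationIdx (𝓞 ℚ) = 1 ∧
      ((N : ℕ) : 𝓞 K) ∈ w.asIdeal := by
  haveI : v.asIdeal.IsMaximal := Ideal.IsPrime.isMaximal v.isPrime v.ne_bot
  obtain ⟨Q, hQmax, hQover⟩ := Ideal.exists_maximal_ideal_liesOver_of_isIntegral (R := 𝓞 ℚ) (S := 𝓞 K) v.asIdeal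
  have hNQ : ((N : ℕ) : 𝓞 K) ∈ Q := by
    rw [hQover.over, Ideal.under_def, Ideal.mem_comap, map_natCast] at hNv
    exact hNv
  have hQ0 : Q ≠ ⊥ := by
    intro hQ
    rw [hQ, Ideal.mem_bot, Nat.cast_eq_zero] at hNQ
    exact hN hNQ
  obtain ⟨w, hw⟩ : ∃ w : HeightOneSpectrum (𝓞 K), w.asIdeal = Q := ⟨⟨Q, hQmax.isPrime, hQ0⟩, rfl⟩
  haveI : w.asIdeal.LiesOver v.asIdeal := by rw [hw]; exact hQover
  have hNw : ((N : ℕ) : 𝓞 K) ∈ w.asIdeal := by rw [hw]; exact hNQ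
  exact ⟨w, inferInstance,
    (ramificationIdx_eq_one_and_inertiaDeg_eq_one_of_natCast_mem_of_satisfiesHeegnerHypothesis hK.1 hH hN w hNw).1, hNw⟩

/-- **The registered stub `stub_nonPhantomAtTwo` of LINE 18 (skeleton v5.2) — its conclusion VERBATIM (the Selmer hypothesis only
at the places of `K` over `2N`), on its frame plus ONE odd multiplicative place `v` of ℚ with `N ∈ v`** (for `N` the conductor: an odd
`p ∥ N`; on the route's habitat this is the clause «`∃ p ≠ 2, p ∥ N`», planner decision (D-NPh)).  Every `M ≥ 1`.  The only place
used is the `w ∣ v` produced by the Heegner hypothesis; `2N ∈ w` because `N ∈ w`.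
[cite: LawsonWuthrich2016, §7.1 and §8] [cite: GrossLMS1991, §1 (the Heegner hypothesis)] -/
theorem nonPhantomAtTwo_of_hasMultiplicativeReductionAt
    (hT : Odd W.tamagawaProduct) (hρ : ∀ n : ℕ, 0 < n → W.HasSurjectiveModNGaloisRep ((2 : ℤ) ^ n))
    (hK : IsImaginaryQuadratic K) (hdK : Odd (NumberField.discr K))
    (hns₁ : ¬ IsSquare ((NumberField.discr K : ℚ) * -|W.Δ|))
    (hns₂ : ¬ IsSquare ((NumberField.discr K : ℚ) * (-(2 * |W.Δ|))))
    {N : ℕ} (hN : N ≠ 0) (hH : SatisfiesHeegnerHypothesis N K)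
    {v : HeightOneSpectrum (𝓞 ℚ)} (h2v : ((2 : ℕ) : 𝓞 ℚ) ∉ v.asIdeal) (hNv : ((N : ℕ) : 𝓞 ℚ) ∈ v.asIdeal)
    (hmult : W.HasMultiplicativeReductionAt v) :
    ∀ (Mlev : ℕ), 1 ≤ Mlev → ∀ z : galH1Torsion (W.baseChange K) ((2 ^ Mlev : ℕ) : ℤ),
      (∀ ρ ∈ torsionFixing (W.baseChange K) ((2 ^ Mlev : ℕ) : ℤ),
        h1Eval (W.baseChange K) ((2 ^ Mlev : ℕ) : ℤ) z ρ = 0) →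
      (∀ w : HeightOneSpectrum (𝓞 K), ((2 * N : ℕ) : 𝓞 K) ∈ w.asIdeal →
        z ∈ selmerLocalKer (W.baseChange K) (w.adicCompletion K) ((2 ^ Mlev : ℕ) : ℤ)) → z = 0 := by
  intro M hM z hz hzS
  obtain ⟨w, hwv, he, hNw⟩ := exists_place_liesOver_of_satisfiesHeegnerHypothesis hK hN hH hNv
  have h2Nw : ((2 * N : ℕ) : 𝓞 K) ∈ w.asIdeal := by
    rw [Nat.cast_mul]; exact w.asIdeal.mul_mem_left _ hNw
  exact eq_zero_baseChange_of_phantom_of_mem_selmerLocalKer_pow W hT hρ hK hdK hns₁ hns₂ h2v hmult w he hM rfl hz (hzS w h2Nw)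

end Summit.BirchSwinnertonDyer.BirchSwinnertonDyer.Theorems.GenusExact.NonPhantomPow

end
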